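import Literature.Analysis.FluidPDE.LeslieShvydkoy2018EnergyStep
import Literature.Analysis.FluidPDE.LeslieShvydkoy2018BlowupFrame
import HarnessLib

/-!
# Leslie–Shvydkoy 2018, Prop. 3.2 with Prop. 4.2: the discharge of
# `leslieShvydkoy2018_morreyBound`

Analysis/FluidPDE proofs file (theorems only; no definitions, no named facts): the DISCHARGE
`leslieShvydkoy2018_morreyBound_holds` of the named fact
`Literature.Analysis.FluidPDE.leslieShvydkoy2018_morreyBound` (`LeslieShvydkoy2018MorreyBound.lean`;
T. M. Leslie, R. Shvydkoy, *The energy measure for the Euler and Navier–Stokes equations*, ARMA 230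
(2018) 459–492 = arXiv:1705.04420, **Prop. 3.2** (p. 9) with **Prop. 4.2** (p. 13)): at a first
blow-up time `T` of the tree's frame (maximal smooth solution, Leray–Hopf from a rapidly decaying
datum, `ν > 0`) a power-law sup rate `‖u(t)‖_∞ ≤ c₀ (T-t)^{-1/q}`, `q ≥ 5/3`, gives the Morrey bound
`∫_{B(x₀,r)} |u(t)|² ≤ C r^{3 - 2/(q-1)}` for all `t ∈ (0,T)`, `x₀`, `r > 0`.

## The proof (printed §3.4 + §4, as rendered in the five preceding files)

Fix `r` and put `t₀ = T - r^{q'}`, `q' = q/(q-1)` ((3.13)). With `f(t) = c₀(T-t)^{-1/q}`: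

* for `t ≤ t₀` the bound is immediate from the rate: `∫_{B_r}|u(t)|² ≤ |B₁| f(t)² r³ ≤
  |B₁| c₀² r^{q'(-2/q)} r³ = |B₁| c₀² r^{3-2/(q-1)}` ("the bound … follows automatically from the
  assumption when `t ∈ [-1, -r^{q'}]`", p. 11);
* for `t₀ < t < T`, Lemma 3.6 iterated — here the Grönwall form `exists_dyadicEnergySup_le_exp` of
  `LeslieShvydkoy2018EnergyStep.lean` on the window `[t₀, t]` — gives
  `∫_{B_r}|u(t)|² ≤ W_r(u(t)) ≤ 8 W_r(u(t₀)) e^{C₁} ≤ 8 |B₁| c₀² r^{3-2/(q-1)} e^{C₁}` with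
  `C₁ = K(ν r^{q'-2} + c₀ q')` bounded for `r ≤ 1` because `q' ≥ 2`, i.e. **`q ≤ 2`** ((3.13):
  `(C₀/r)∫_{t₀}^0 f ≤ C₀ c₀ q' t₀^{1/q'} r⁻¹ = C₁`; (4.1)–(4.2): the viscous term is admissible
  exactly for `5/3 ≤ q ≤ 2`);
* for large `r` (`r > 1` or `r^{q'} > T/2`) the bound holds with the total energy `2E(u₀)`;
* for **`q > 2`** the paper notes "the conclusion is trivial whenever `q > 2`, by the Prodi–Serrin
  criterion" (p. 13): on the tree's frame the hypotheses are then contradictory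
  (`false_of_rate_of_two_lt` of `LeslieShvydkoy2018BlowupFrame.lean`), since Leray's lower
  blow-up rate (`leray_blowup_rate_top_holds`, Leray 1934 (3.9)) gives
  `c√ν (T-t)^{-1/2} ≤ ‖u(t)‖_∞ ≤ c₀ (T-t)^{-1/q}`, impossible as `t → T` when `1/q < 1/2`.

The pressure of the frame is an arbitrary classical pressure; it is gauged to the normalised
pressure `RᵢRⱼ(uᵢuⱼ)` at a.e. time by Tao's normalisation lemma (the tree's
`tao_pressure_normalisation_holds`, via `ae_pressure_gauge_slab` of
`LeslieShvydkoy2018BlowupFrame.lean`), which is the paper's standing convention `p = RᵢRⱼ(uᵢuⱼ)`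
(§1, p. 3).

## References

* T. M. Leslie, R. Shvydkoy, ARMA 230 (2018) = arXiv:1705.04420, Prop. 3.2, §3.4 (pp. 9–12),
  Prop. 4.2, §4 (p. 13). [`LeslieShvydkoy2017`]
* J. Leray, Acta Math. 63 (1934), §20 (3.9) (lower blow-up rate). [`Leray1934`]
* T. Tao, Anal. PDE 6 (2013) = arXiv:1108.1165, Lemma 4.1 (i) (pressure normalisation). [`Tao2011`]
-/

noncomputable section

open MeasureTheory Set Metric Filter Function InnerProductSpace
open _root_.Topology
open scoped ENNReal NNReal RealInnerProductSpace

namespace Literature.Analysis.FluidPDE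


/-! ### The discharge -/

open LeslieShvydkoy2018 in
/-- **Leslie–Shvydkoy 2018, Prop. 3.2 with Prop. 4.2 (3D Navier–Stokes, first blow-up time,
power-law sup rate) — PROVED.** The discharge of the named fact
`leslieShvydkoy2018_morreyBound`: on the tree's first-blow-up frame (maximal smooth solution on
`[0,T)`, Leray–Hopf from a rapidly decaying datum, `ν > 0`), a rate
`‖u(t,x)‖ ≤ c₀ (T-t)^{-1/q}`, `q ≥ 5/3`, yields `∫_{B(x₀,r)} |u(t)|² ≤ C r^{3-2/(q-1)}` for all
`t ∈ (0,T)`, `x₀`, `r > 0`. Proof: §3.4 of the paper (Lemma 3.6 and the iteration (3.12')–(3.14),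
rendered as a Grönwall inequality for the dyadic energy supremum, files
`LeslieShvydkoy2018DyadicEnergy/SlicePressure/EnergyFlux/EnergyStep`) with the viscous term of
§4 (4.1)–(4.2) for `5/3 ≤ q ≤ 2`; for `q > 2` the hypotheses contradict Leray's lower blow-up rate
(`false_of_rate_of_two_lt`). [cite: LeslieShvydkoy2017, Prop. 3.2 (p. 9), §3.4 (pp. 10–12), Prop. 4.2 and §4 (p. 13)] -/
theorem leslieShvydkoy2018_morreyBound_holds : leslieShvydkoy2018_morreyBound := by
  intro ν T q hν hT hq u p hmax hLH _hdec hrate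
  obtain ⟨c₀, hc₀⟩ := hrate
  -- ### `q > 2`: contradiction
  rcases lt_or_ge 2 q with hq2 | hq2
  · exact (false_of_rate_of_two_lt hν hT hq2 hmax hLH hc₀).elim
  -- ### `5/3 ≤ q ≤ 2`
  have hc₀n : 0 ≤ c₀ := rate_const_nonneg hT hc₀
  have hq1 : 1 < q := by linarith
  have hq0 : 0 < q := by linarith
  have hqm1 : 0 < q - 1 := by linarith
  -- exponents
  set θ : ℝ := 3 - 2 / (q - 1) with hθ
  set q' : ℝ := q / (q - 1) with hq'
  have hθ0 : 0 ≤ θ := by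
    rw [hθ, sub_nonneg, div_le_iff₀ hqm1]; linarith
  have hq'2 : 2 ≤ q' := by
    rw [hq', le_div_iff₀ hqm1]; linarith
  have hq'0 : 0 < q' := by linarith
  have hq'q : q' * (-(2 / q)) + 3 = θ := by
    rw [hq', hθ]; field_simp; ring
  have h1q : 1 - 1 / q = 1 / q' := by
    rw [hq']; field_simp
  have hq'inv : q' * (1 - 1 / q) = 1 := by
    rw [h1q]; field_simp
  -- constants of the step machinery
  obtain ⟨K, hK⟩ := exists_dyadicEnergySup_le_exp
  set V : ℝ≥0∞ := volume (ball (0 : EuclideanSpace ℝ (Fin 3)) 1) with hV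
  have hVtop : V ≠ ⊤ := measure_ball_lt_top.ne
  set E₀ : ℝ≥0∞ := ENNReal.ofReal (2 * VectorCalculus.kineticEnergy (u 0)) with hE₀
  have hE₀top : E₀ ≠ ⊤ := ENNReal.ofReal_ne_top
  have hEτ : ∀ τ ∈ Ioo 0 T, ∫⁻ y, ‖u τ y‖ₑ ^ 2 ≤ E₀ := fun τ hτ =>
    lintegral_sq_le_energy hν.le hLH ⟨hτ.1.le, hτ.2.le⟩
  -- the scale threshold `r* = min 1 (T/2)^{1/q'}`
  set r₁ : ℝ := (T / 2) ^ (1 / q') with hr₁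
  have hr₁0 : 0 < r₁ := Real.rpow_pos_of_pos (by positivity) _
  set rs : ℝ := min 1 r₁ with hrs
  have hrs0 : 0 < rs := lt_min one_pos hr₁0
  -- the exponential constant
  set L : ℝ := (K : ℝ) * (|ν| + c₀ * (1 / (1 - 1 / q))) with hL
  -- the final constant
  set Csmall : ℝ := 8 * (V.toReal * c₀ ^ 2) * Real.exp L with hCsmall
  set Clarge : ℝ := E₀.toReal / rs ^ θ with hClarge
  refine ⟨max Csmall Clarge + V.toReal * c₀ ^ 2, fun t ht x₀ r hr => ?_⟩
  have hVc0 : 0 ≤ V.toReal * c₀ ^ 2 := by positivity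
  have hCs0 : 0 ≤ Csmall := by positivity
  have hmax_le : ∀ {a : ℝ}, a ≤ max Csmall Clarge → ENNReal.ofReal (a * r ^ θ) ≤
      ENNReal.ofReal ((max Csmall Clarge + V.toReal * c₀ ^ 2) * r ^ θ) := fun ha =>
    ENNReal.ofReal_le_ofReal (mul_le_mul_of_nonneg_right (by linarith) (Real.rpow_nonneg hr.le _))
  -- ### large scales: the total energy
  by_cases hlarge : rs < r
  · have hrθ : rs ^ θ ≤ r ^ θ := Real.rpow_le_rpow hrs0.le hlarge.le hθ0
    have hrsθ : 0 < rs ^ θ := Real.rpow_pos_of_pos hrs0 _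
    calc ∫⁻ y in ball x₀ r, ‖u t y‖ₑ ^ 2 ≤ ∫⁻ y, ‖u t y‖ₑ ^ 2 := setLIntegral_le_lintegral _ _
      _ ≤ E₀ := hEτ t ht
      _ = ENNReal.ofReal (Clarge * rs ^ θ) := by
          rw [hClarge, div_mul_cancel₀ _ hrsθ.ne', ENNReal.ofReal_toReal hE₀top]
      _ ≤ ENNReal.ofReal (Clarge * r ^ θ) := by
          refine ENNReal.ofReal_le_ofReal (mul_le_mul_of_nonneg_left hrθ ?_)
          rw [hClarge]; positivity
      _ ≤ _ := hmax_le (le_max_right _ _)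
  -- ### small scales: `r ≤ 1`, `r^{q'} ≤ T/2`
  push Not at hlarge
  have hr1 : r ≤ 1 := hlarge.trans (min_le_left _ _)
  have hrq' : r ^ q' ≤ T / 2 := by
    have h : r ≤ r₁ := hlarge.trans (min_le_right _ _)
    calc r ^ q' ≤ r₁ ^ q' := Real.rpow_le_rpow hr.le h hq'0.le
      _ = T / 2 := by
          rw [hr₁, ← Real.rpow_mul (by positivity), one_div_mul_cancel hq'0.ne', Real.rpow_one]
  have hrq'0 : 0 < r ^ q' := Real.rpow_pos_of_pos hr _
  set t₀ : ℝ := T - r ^ q' with ht₀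
  have ht₀0 : 0 < t₀ := by rw [ht₀]; linarith
  have ht₀T : t₀ < T := by rw [ht₀]; linarith
  have hTt₀ : T - t₀ = r ^ q' := by rw [ht₀]; ring
  -- the sup bound at times `τ ≤ t₀`... and in general `f(τ)² r³ |B₁|`
  set f : ℝ → ℝ := fun τ => c₀ * (T - τ) ^ (-(1 / q)) with hf
  have hfτ : ∀ τ ∈ Ioo 0 T, ∀ x, ‖u τ x‖ ≤ f τ := fun τ hτ x => hc₀ τ ⟨hτ.1.le, hτ.2⟩ x
  -- `f(τ)² r³ ≤ c₀² r^θ` for `τ ≤ t₀`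
  have hfsq : ∀ τ, τ ≤ t₀ → τ < T → f τ ^ 2 * r ^ 3 ≤ c₀ ^ 2 * r ^ θ := by
    intro τ hτ hτT
    have hTτ : r ^ q' ≤ T - τ := by rw [← hTt₀]; linarith
    have hpow : (T - τ) ^ (-(1 / q)) ≤ (r ^ q') ^ (-(1 / q)) :=
      Real.rpow_le_rpow_of_nonpos hrq'0 hTτ (by rw [neg_nonpos]; positivity)
    have hpow0 : 0 ≤ (T - τ) ^ (-(1 / q)) := Real.rpow_nonneg (by linarith) _
    have e : ((r ^ q') ^ (-(1 / q))) ^ 2 * r ^ 3 = r ^ θ := by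
      rw [← Real.rpow_mul hr.le, ← Real.rpow_natCast (r ^ (q' * -(1 / q))) 2,
        ← Real.rpow_mul hr.le, ← Real.rpow_natCast r 3, ← Real.rpow_add hr]
      congr 1
      push_cast
      rw [← hq'q]; ring
    calc f τ ^ 2 * r ^ 3 = c₀ ^ 2 * (((T - τ) ^ (-(1 / q))) ^ 2 * r ^ 3) := by rw [hf]; ring
      _ ≤ c₀ ^ 2 * (((r ^ q') ^ (-(1 / q))) ^ 2 * r ^ 3) := by gcongr
      _ = c₀ ^ 2 * r ^ θ := by rw [e]
  -- `|B₁| f(τ)² r³ ≤ V c₀² r^θ` as an `ℝ≥0∞` bound usable for `τ ≤ t₀`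
  have hinit : ∀ τ, τ ≤ t₀ → τ < T →
      ENNReal.ofReal (f τ ^ 2 * r ^ 3) * V ≤ ENNReal.ofReal (V.toReal * c₀ ^ 2 * r ^ θ) := by
    intro τ hτ hτT
    rw [mul_comm, mul_assoc, ENNReal.ofReal_mul ENNReal.toReal_nonneg, ENNReal.ofReal_toReal hVtop]
    gcongr V * ENNReal.ofReal ?_
    exact hfsq τ hτ hτT
  -- ### times `t ≤ t₀`: directly from the rate
  by_cases htt₀ : t ≤ t₀
  · calc ∫⁻ y in ball x₀ r, ‖u t y‖ₑ ^ 2 ≤ ENNReal.ofReal (f t ^ 2 * r ^ 3) * V :=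
          ballEnergySq_le_of_norm_le (hfτ t ht) hr.le
      _ ≤ ENNReal.ofReal (V.toReal * c₀ ^ 2 * r ^ θ) := hinit t htt₀ ht.2
      _ ≤ ENNReal.ofReal ((max Csmall Clarge + V.toReal * c₀ ^ 2) * r ^ θ) := by
          refine ENNReal.ofReal_le_ofReal (mul_le_mul_of_nonneg_right ?_ (Real.rpow_nonneg hr.le _))
          linarith [le_max_left Csmall Clarge]
  -- ### times `t₀ < t < T`: Lemma 3.6 iterated (Grönwall) on `[t₀, t]`
  push Not at htt₀
  -- the open time set `S = (0, T')`, `T' = (t + T)/2`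
  set T' : ℝ := (t + T) / 2 with hT'
  have hT'mem : T' ∈ Ioo 0 T := ⟨by rw [hT']; linarith [ht.1], by rw [hT']; linarith [ht.2]⟩
  have htT' : t < T' := by rw [hT']; linarith [ht.2]
  set S : Set ℝ := Ioo 0 T' with hS
  have hSsub : S ⊆ Ioo 0 T := fun τ hτ => ⟨hτ.1, hτ.2.trans hT'mem.2⟩
  have hsolS : IsClassicalNSSolutionOn S ν 0 u p :=
    hmax.1.mono (fun τ hτ => ⟨hτ.1.le, hτ.2.trans hT'mem.2⟩) isOpen_Ioo.uniqueDiffOn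
  have hgauge := ae_pressure_gauge_slab hν hmax hLH hT'mem
  have hL2 : ∀ τ ∈ S, MemLp (u τ) 2 volume := fun τ hτ =>
    hLH.memLp τ ⟨hτ.1.le, (hSsub hτ).2.le⟩
  have hfS : ∀ τ ∈ S, ∀ x, ‖u τ x‖ ≤ f τ := fun τ hτ => hfτ τ (hSsub hτ)
  have hES : ∀ τ ∈ S, ∫⁻ y, ‖u τ y‖ₑ ^ 2 ≤ E₀ := fun τ hτ => hEτ τ (hSsub hτ)
  have hI : Icc t₀ t ⊆ S := fun τ hτ => ⟨ht₀0.trans_le hτ.1, hτ.2.trans_lt htT'⟩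
  -- the kernel integral on the window
  have hfin_le : ∫⁻ τ in Ioo t₀ t, ENNReal.ofReal (f τ) ≤
      ENNReal.ofReal (c₀ * ((T - t₀) ^ (1 - 1 / q) / (1 - 1 / q))) :=
    lintegral_rate_le hc₀n hq1 htt₀.le ht.2
  have hfin : ∫⁻ τ in Ioo t₀ t, ENNReal.ofReal (f τ) ≠ ⊤ :=
    ne_top_of_le_ne_top ENNReal.ofReal_ne_top hfin_le
  have hG := hK S ν u p f E₀ hsolS isOpen_Ioo hν.le hgauge hL2 hfS hE₀top hES x₀ r t₀ t hr
    htt₀.le hI hfin t (right_mem_Icc.2 htt₀.le)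
  -- bound the exponential factor
  have hexp : ENNReal.ofReal (Real.exp (∫⁻ τ in Ioo t₀ t,
      K * (ENNReal.ofReal (|ν| / r ^ 2) + ENNReal.ofReal (f τ / r))).toReal) ≤
      ENNReal.ofReal (Real.exp L) := by
    refine ENNReal.ofReal_le_ofReal (Real.exp_le_exp.2 ?_)
    -- compute the kernel integral
    have hsplit : ∀ τ, (K : ℝ≥0∞) * (ENNReal.ofReal (|ν| / r ^ 2) + ENNReal.ofReal (f τ / r)) =
        K * ENNReal.ofReal (|ν| / r ^ 2) + (K * ENNReal.ofReal r⁻¹) * ENNReal.ofReal (f τ) := by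
      intro τ
      rw [mul_add, div_eq_mul_inv (f τ), ENNReal.ofReal_mul' (inv_nonneg.2 hr.le)]
      ring
    have hval : ∫⁻ τ in Ioo t₀ t, (K : ℝ≥0∞) * (ENNReal.ofReal (|ν| / r ^ 2) + ENNReal.ofReal (f τ / r))
        ≤ ENNReal.ofReal L := by
      simp_rw [hsplit]
      rw [lintegral_add_left' aemeasurable_const, lintegral_const_mul' _ _
        (ENNReal.mul_ne_top ENNReal.coe_ne_top ENNReal.ofReal_ne_top), lintegral_const,
        Measure.restrict_apply_univ, Real.volume_Ioo]
      -- `K |ν|/r² (t - t₀) + K r⁻¹ ∫ f ≤ K(|ν| r^{q'-2} + c₀ q'⁻¹…) ≤ L`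
      have h1 : (K : ℝ≥0∞) * ENNReal.ofReal (|ν| / r ^ 2) * ENNReal.ofReal (t - t₀) ≤
          ENNReal.ofReal ((K : ℝ) * |ν|) := by
        rw [show ((K : ℝ≥0) : ℝ≥0∞) = ENNReal.ofReal (K : ℝ) from (ENNReal.ofReal_coe_nnreal).symm,
          ← ENNReal.ofReal_mul K.coe_nonneg, ← ENNReal.ofReal_mul (by positivity)]
        refine ENNReal.ofReal_le_ofReal ?_
        have htt : t - t₀ ≤ r ^ q' := by rw [ht₀]; linarith [ht.2]
        have hrq'2 : r ^ q' ≤ r ^ 2 := by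
          rw [show (r : ℝ) ^ (2 : ℕ) = r ^ (2 : ℝ) by norm_cast]
          exact Real.rpow_le_rpow_of_exponent_ge hr hr1 hq'2
        have hr2 : 0 < r ^ 2 := by positivity
        calc (K : ℝ) * (|ν| / r ^ 2) * (t - t₀) ≤ K * (|ν| / r ^ 2) * r ^ 2 := by
              gcongr; exact htt.trans hrq'2
          _ = K * |ν| := by field_simp
      have h2 : (K : ℝ≥0∞) * ENNReal.ofReal r⁻¹ * ∫⁻ τ in Ioo t₀ t, ENNReal.ofReal (f τ) ≤
          ENNReal.ofReal ((K : ℝ) * (c₀ * (1 / (1 - 1 / q)))) := by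
        rw [show ((K : ℝ≥0) : ℝ≥0∞) = ENNReal.ofReal (K : ℝ) from (ENNReal.ofReal_coe_nnreal).symm]
        calc ENNReal.ofReal (K : ℝ) * ENNReal.ofReal r⁻¹ * ∫⁻ τ in Ioo t₀ t, ENNReal.ofReal (f τ)
            ≤ ENNReal.ofReal (K : ℝ) * ENNReal.ofReal r⁻¹ *
                ENNReal.ofReal (c₀ * ((T - t₀) ^ (1 - 1 / q) / (1 - 1 / q))) := by gcongr
          _ = ENNReal.ofReal ((K : ℝ) * (r⁻¹ * (c₀ * ((T - t₀) ^ (1 - 1 / q) / (1 - 1 / q))))) := by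
              rw [mul_assoc, ← ENNReal.ofReal_mul (inv_nonneg.2 hr.le),
                ← ENNReal.ofReal_mul K.coe_nonneg]
          _ = ENNReal.ofReal ((K : ℝ) * (c₀ * (1 / (1 - 1 / q)))) := by
              congr 1
              rw [hTt₀, ← Real.rpow_mul hr.le, hq'inv, Real.rpow_one]
              field_simp
      calc (K : ℝ≥0∞) * ENNReal.ofReal (|ν| / r ^ 2) * ENNReal.ofReal (t - t₀) +
            (K : ℝ≥0∞) * ENNReal.ofReal r⁻¹ * ∫⁻ τ in Ioo t₀ t, ENNReal.ofReal (f τ)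
          ≤ ENNReal.ofReal ((K : ℝ) * |ν|) + ENNReal.ofReal ((K : ℝ) * (c₀ * (1 / (1 - 1 / q)))) :=
            add_le_add h1 h2
        _ = ENNReal.ofReal L := by
            rw [← ENNReal.ofReal_add (by positivity) (mul_nonneg K.coe_nonneg (mul_nonneg hc₀n
              (by rw [h1q]; positivity))), hL]
            ring_nf
    have hL0 : 0 ≤ L := by
      rw [hL]; exact mul_nonneg K.coe_nonneg (add_nonneg (abs_nonneg _) (mul_nonneg hc₀n
        (by rw [h1q]; positivity)))
    calc (∫⁻ τ in Ioo t₀ t, (K : ℝ≥0∞) * (ENNReal.ofReal (|ν| / r ^ 2) + ENNReal.ofReal (f τ / r))).toReal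
        ≤ (ENNReal.ofReal L).toReal := ENNReal.toReal_mono ENNReal.ofReal_ne_top hval
      _ = L := ENNReal.toReal_ofReal hL0
  -- assemble
  calc ∫⁻ y in ball x₀ r, ‖u t y‖ₑ ^ 2 ≤ dyadicEnergySup (u t) x₀ r := ballEnergySq_le_dyadicEnergySup
    _ ≤ 8 * dyadicEnergySup (u t₀) x₀ r * ENNReal.ofReal (Real.exp (∫⁻ τ in Ioo t₀ t,
          K * (ENNReal.ofReal (|ν| / r ^ 2) + ENNReal.ofReal (f τ / r))).toReal) := hG
    _ ≤ 8 * (ENNReal.ofReal (f t₀ ^ 2 * r ^ 3) * V) * ENNReal.ofReal (Real.exp L) := by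
        gcongr
        exact dyadicEnergySup_le_of_norm_le (hfτ t₀ ⟨ht₀0, ht₀T⟩) hr.le
    _ ≤ 8 * ENNReal.ofReal (V.toReal * c₀ ^ 2 * r ^ θ) * ENNReal.ofReal (Real.exp L) := by
        gcongr
        exact hinit t₀ le_rfl ht₀T
    _ = ENNReal.ofReal (Csmall * r ^ θ) := by
        rw [hCsmall, show (8 : ℝ≥0∞) = ENNReal.ofReal 8 by norm_num,
          ← ENNReal.ofReal_mul (by norm_num), ← ENNReal.ofReal_mul (by positivity)]
        congr 1; ring
    _ ≤ _ := hmax_le (le_max_left _ _)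

/-- **No energy concentration at a first blow-up with a sub-`5/3` power rate — now unconditional**
(the proved consequence `leslieShvydkoy2018_morreyBound.noConcentration` fed with the discharge):
`∀ ε > 0, ∃ r > 0, ∀ t ∈ (0,T), ∀ x₀, ∫_{B(x₀,r)} |u(t)|² ≤ ε` at a first blow-up of the frame with
`‖u(t)‖_∞ ≤ c₀ (T-t)^{-1/q}`, `q > 5/3`. [cite: LeslieShvydkoy2017, Prop. 3.2 + 4.2 (pp. 9, 13) with §1.3 (p. 5)] -/
theorem leslieShvydkoy2018_noConcentration_of_rate {ν T q : ℝ} (hν : 0 < ν) (hT : 0 < T) (hq : 5 / 3 < q)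
    {u : ℝ → EuclideanSpace ℝ (Fin 3) → EuclideanSpace ℝ (Fin 3)}
    {p : ℝ → EuclideanSpace ℝ (Fin 3) → ℝ}
    (hmax : IsMaximalSmoothSolution ν 0 u p T) (hLH : IsLerayHopfOn T ν 0 (u 0) u)
    (hdec : HasRapidSpatialDecay (u 0))
    (hrate : ∃ c₀ : ℝ, ∀ t ∈ Ico 0 T, ∀ x, ‖u t x‖ ≤ c₀ * (T - t) ^ (-(1 / q))) :
    ∀ ε : ℝ, 0 < ε → ∃ r : ℝ, 0 < r ∧ ∀ t ∈ Ioo 0 T, ∀ x₀ : EuclideanSpace ℝ (Fin 3),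
      ∫⁻ y in ball x₀ r, ‖u t y‖ₑ ^ 2 ≤ ENNReal.ofReal ε :=
  leslieShvydkoy2018_morreyBound.noConcentration leslieShvydkoy2018_morreyBound_holds hν hT hq hmax
    hLH hdec hrate

end Literature.Analysis.FluidPDE

end
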